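import Summits.PneNP.PneNP.Theorems.CodingVolumeShiftsCodingVolumeGraded

/-!
# Route CodingVolumeShifts — crux `CodingVolume` (stmt-PneNP-19454): the potential (moving-cut)
# certificate, and the boundary cell `k ≤ 1`

Two small additions to the volume ladder X = `CodingVolume`.

* `codingVolume_potential_certificate` — the HYPOTHESIS-FREE form of every cut-summation argument
  in the ladder: for a k-pairs network carrying a binary one-shot code and ANY integer potential
  `p` on the vertices, `Σ_i (p (sink i) ∸ p (source i)) ≤ Σ_a (p (tgt a) ∸ p (src a))` — every
  commodity must cross each level set `{v | ρ ≤ p v}` between `p (source i)` and `p (sink i)`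
  (cut-set bound `codingVolume_cut_bound`), and an arc is charged once per level it climbs. No
  monotonicity of `p` along arcs, no distance hypothesis and no degree bound are needed. The stretch
  bound (`codingVolume_mul_card_le_sum_stretch`, strict potentials), the graded and cross-far cells
  and the nearest-terminal laws are all instances; it is the one-shot-DAG form of the "moving cut"
  certificate of Haeupler–Wajc–Zuzic (FOCS 2020, makespan of multiple unicasts), whose length
  version is `codingVolume_movingCut`: arc lengths `ℓ` dominating the climbs of `p`, all own pairs
  `p`-separated by `T`, give `T·k ≤ Σ_a ℓ a`. What separates such certificates from X is that for
  own-pair-far networks with sinks next to foreign sources no potential separates all own pairs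
  (the arcs `source j → sink i` cap `p (sink i)`), so X needs restriction to sub-families first.
* `codingVolume_cell_card_le_one` — the boundary column `k ≤ 1` of the ladder, every `C` with
  `L = C`: a single `L`-far coded pair already forces `L` arcs (`codingVolume_exists_dep_arcs`);
  crux-shaped `codingVolume_rung_card_le_one`.

No definitions; route-independent. [folklore]
-/

set_option linter.dupNamespace false -- `Summit.PneNP.PneNP.…`: summit = sub-problem name (D-0017)

namespace Summit.PneNP.PneNP.Theorems

open Literature.InformationTheory.NetworkCoding Finset

section Potential

variable {ι : Type} {N : KPairsNet ι}

/-- **POTENTIAL CERTIFICATE (hypothesis-free).** For every k-pairs network with a binary one-shot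
code and every potential `p : V → ℕ`:
`Σ_i (p (sink i) ∸ p (source i)) ≤ Σ_a (p (tgt a) ∸ p (src a))` (truncated subtraction on both
sides). Proof: for each threshold `ρ`, the cut-set bound for `{v | ρ ≤ p v}` says that the
commodities with `p (source i) < ρ ≤ p (sink i)` are at most the arcs with `p (src a) < ρ ≤ p (tgt a)`;
sum over `ρ`. [folklore] -/
theorem codingVolume_potential_certificate [Fintype ι] (N : KPairsNet ι) (c : N.Code)
    (p : N.V → ℕ) :
    ∑ i, (p (N.sink i) - p (N.source i)) ≤ ∑ a, (p (N.tgt a) - p (N.src a)) := by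
  classical
  set B : ℕ := univ.sup p + 1 with hB
  have hltB : ∀ v, p v < B := fun v =>
    Nat.lt_succ_of_le (Finset.le_sup (f := p) (Finset.mem_univ v))
  have hcut : ∀ ρ, (univ.filter fun i => p (N.source i) < ρ ∧ ρ ≤ p (N.sink i)).card ≤
      (univ.filter fun a => p (N.src a) < ρ ∧ ρ ≤ p (N.tgt a)).card := by
    intro ρ
    have h := codingVolume_cut_bound c (univ.filter fun v => ρ ≤ p v)
    refine le_trans (le_of_eq ?_) (h.trans (le_of_eq ?_))
    · congr 1
      ext i
      simp only [Finset.mem_filter, Finset.mem_univ, true_and, not_le]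
      exact and_comm
    · congr 1
      ext a
      simp only [Finset.mem_filter, Finset.mem_univ, true_and, not_le]
  calc ∑ i, (p (N.sink i) - p (N.source i))
      = ∑ ρ ∈ range B, (univ.filter fun i => p (N.source i) < ρ ∧ ρ ≤ p (N.sink i)).card :=
        (codingVolume_sum_card_filter_Ioc _ _ B fun i => hltB _).symm
    _ ≤ ∑ ρ ∈ range B, (univ.filter fun a => p (N.src a) < ρ ∧ ρ ≤ p (N.tgt a)).card :=
        Finset.sum_le_sum fun ρ _ => hcut ρ
    _ = ∑ a, (p (N.tgt a) - p (N.src a)) :=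
        codingVolume_sum_card_filter_Ioc _ _ B fun a => hltB _

/-- **MOVING-CUT CERTIFICATE (length form).** If arc lengths `ℓ` dominate the climbs of a potential
`p` (`p (tgt a) ≤ p (src a) + ℓ a`; descents are free) and `p` separates every source from ITS OWN
sink by `T` (`p (source i) + T ≤ p (sink i)`), then `T·k ≤ Σ_a ℓ a`. With `ℓ ≡ 1` and `p` the
undirected distance from the set of all sources this is the cross-far cell; with a strict potential
it is the stretch bound. [folklore] -/
theorem codingVolume_movingCut [Fintype ι] (N : KPairsNet ι) (c : N.Code) (p : N.V → ℕ)
    (ℓ : N.A → ℕ) (hℓ : ∀ a, p (N.tgt a) ≤ p (N.src a) + ℓ a) {T : ℕ}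
    (hT : ∀ i, p (N.source i) + T ≤ p (N.sink i)) : T * Fintype.card ι ≤ ∑ a, ℓ a := by
  have h := codingVolume_potential_certificate N c p
  calc T * Fintype.card ι = ∑ _i : ι, T := by simp [mul_comm]
    _ ≤ ∑ i, (p (N.sink i) - p (N.source i)) :=
        Finset.sum_le_sum fun i _ => by have := hT i; omega
    _ ≤ ∑ a, (p (N.tgt a) - p (N.src a)) := h
    _ ≤ ∑ a, ℓ a := Finset.sum_le_sum fun a _ => by have := hℓ a; omega

/-- The unit-length case: if a potential climbs at most one per arc and separates every own pair by
`T`, then `T·k ≤ m`. [folklore] -/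
theorem codingVolume_movingCut_unit [Fintype ι] (N : KPairsNet ι) (c : N.Code) (p : N.V → ℕ)
    (hp : ∀ a, p (N.tgt a) ≤ p (N.src a) + 1) {T : ℕ} (hT : ∀ i, p (N.source i) + T ≤ p (N.sink i)) :
    T * Fintype.card ι ≤ N.arcCount := by
  have h := codingVolume_movingCut N c p (fun _ => 1) hp hT
  simpa [KPairsNet.arcCount] using h

end Potential

section One

variable {ι : Type} {N : KPairsNet ι}

/-- **The column `k ≤ 1` of the ladder (arc form).** A coded network with at most one commodity, whose
pair is `L`-far, has at least `L·k` arcs: at least `L` arcs carry a bit depending on that commodity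
(`codingVolume_exists_dep_arcs`). [folklore] -/
theorem codingVolume_cell_card_le_one [Fintype ι] (N : KPairsNet ι) {L : ℕ} (hfar : N.Far L)
    (c : N.Code) (hk : Fintype.card ι ≤ 1) : L * Fintype.card ι ≤ N.arcCount := by
  classical
  rcases Nat.lt_or_ge (Fintype.card ι) 1 with h0 | h1
  · have : Fintype.card ι = 0 := by omega
    rw [this, mul_zero]
    exact Nat.zero_le _
  · have hk1 : Fintype.card ι = 1 := le_antisymm hk h1
    obtain ⟨i⟩ : Nonempty ι := Fintype.card_pos_iff.mp (by omega)
    obtain ⟨s, hs, -⟩ := codingVolume_exists_dep_arcs c i (hfar i)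
    rw [hk1, mul_one]
    exact hs.trans (Finset.card_le_univ s)

/-- **Rung of `CodingVolume` (crux stmt-PneNP-19454): every cell `(Δ, C)` for `k ≤ 1`, in the shape
of the crux** (with `L := C`; degree bound unused). [folklore] -/
theorem codingVolume_rung_card_le_one : ∀ Δ C : ℕ, ∃ L : ℕ, ∀ (ι : Type) [Fintype ι]
    (N : KPairsNet ι), Fintype.card ι ≤ 1 → N.DegLE Δ → N.Far L → Nonempty N.Code →
    C * Fintype.card ι ≤ N.arcCount :=
  fun _ C => ⟨C, fun _ _ N hk _ hfar hc => hc.elim fun c => codingVolume_cell_card_le_one N hfar c hk⟩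

end One

end Summit.PneNP.PneNP.Theorems
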